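import Summits.Parity.BatemanHorn.Theorems.SoloInformedLocatedHeuristic

/-!
# SoloInformedLocatedPrimeModuli — prime moduli carry only `O(x)` of the located root count

Solo unit `solo-Parity-informed` (ideation tier, informed mode), session 136; `PLAN.md` §101, CLAIMS C226.

The located root count `Mid_g(x) = #{(n, e) : n ≤ x < e, e ∣ g(n), e² < |g(n)|}` of an irreducible `g ∈ ℤ[X]` of degree
`d ≥ 2` is conjecturally `((d−2)/2)·A_g·x log x` (`LocatedRootCountAsymptotic`, equivalent to Erdős's asymptotic for
`∑τ(|g(n)|)` and to window root equidistribution, `SoloInformedLocatedHeuristic`).  Its PRIME moduli are negligible: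

* `card_primeFactors_filter_mul_log_le` — an integer `N ≥ 1` has at most `log N / log x` prime factors exceeding `x`;
* `exists_polyLocatedPrimeCount_le` — hence `#{(n, p) : n ≤ x < p prime, p ∣ g(n), p² < |g(n)|} ≤ C·x` for `x ≥ 2`
  (from `log|g(n)| = d log n + O(1)`), i.e. `O(x) = o(x log x)`;
* `locatedRootCountAsymptotic_iff_composite` — so the located-root-count conjecture is a statement about COMPOSITE moduli
  `e ∈ (x, √|g(n)|)` alone.

Consequence for the placement of the problem: the "largest prime factor of `g(n)`" theorems (Hooley, Heath-Brown 2001, Irving 2015),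
which control roots of `g` to PRIME moduli slightly beyond `x`, are orthogonal at first order to the divisor-sum residual, which lives
on composite moduli longer than the range of `n`.  Elementary; no sorry.
-/

namespace Summit.Parity.BatemanHorn.Theorems

open Finset Filter Polynomial
open scoped Topology

/-- The located PRIME root count: pairs `(n, p)` with `1 ≤ n ≤ x`, `p` prime, `p ∣ g(n)`, `x < p`, `p² < |g(n)|`. -/
def polyLocatedPrimeCount (g : ℤ[X]) (x : ℕ) : ℕ :=
  ∑ n ∈ Icc 1 x,
    #((((g.eval (n : ℤ)).natAbs.divisors).filter fun e => x < e ∧ e * e < (g.eval (n : ℤ)).natAbs).filter Nat.Prime)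

/-- The located prime root count is at most the located root count. -/
theorem polyLocatedPrimeCount_le (g : ℤ[X]) (x : ℕ) : polyLocatedPrimeCount g x ≤ polyLocatedRootCount g x := by
  unfold polyLocatedPrimeCount polyLocatedRootCount
  exact sum_le_sum fun n _ => card_le_card (filter_subset _ _)

/-- **Few large prime factors**: for `N ≥ 1` and `x ≥ 1`, `#{p ∣ N prime : x < p} · log x ≤ log N`. -/
theorem card_primeFactors_filter_mul_log_le {N x : ℕ} (hN : N ≠ 0) (hx : 1 ≤ x) :
    (#(N.primeFactors.filter fun p => x < p) : ℝ) * Real.log x ≤ Real.log N := by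
  set P := N.primeFactors.filter fun p => x < p with hP
  have hsub : P ⊆ N.primeFactors := filter_subset _ _
  have hdvd : ∏ p ∈ P, p ∣ N :=
    (Finset.prod_dvd_prod_of_subset P N.primeFactors (fun p => p) hsub).trans (Nat.prod_primeFactors_dvd N)
  have hle : ∏ p ∈ P, p ≤ N := Nat.le_of_dvd (Nat.pos_of_ne_zero hN) hdvd
  have hpos : ∀ p ∈ P, (0 : ℝ) < p := fun p hp =>
    by exact_mod_cast (Nat.prime_of_mem_primeFactors (hsub hp)).pos
  have hprodpos : (0 : ℝ) < ∏ p ∈ P, (p : ℝ) := prod_pos hpos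
  have hleR : (∏ p ∈ P, (p : ℝ)) ≤ (N : ℝ) := by
    have h := (Nat.cast_le (α := ℝ)).mpr hle
    rwa [Nat.cast_prod] at h
  have hlogprod : Real.log (∏ p ∈ P, (p : ℝ)) ≤ Real.log N := Real.log_le_log hprodpos hleR
  rw [Real.log_prod (s := P) (f := fun p : ℕ => (p : ℝ)) (fun p hp => (hpos p hp).ne')] at hlogprod
  have hterm : ∀ p ∈ P, Real.log (x : ℝ) ≤ Real.log (p : ℝ) := by
    intro p hp
    have hxp : x < p := (mem_filter.mp hp).2
    exact Real.log_le_log (by exact_mod_cast hx) (by exact_mod_cast hxp.le)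
  have hcard := Finset.card_nsmul_le_sum P (fun p : ℕ => Real.log (p : ℝ)) (Real.log (x : ℝ)) hterm
  rw [nsmul_eq_mul] at hcard
  linarith

/-- **Prime moduli carry `O(x)` of the located root count**: for irreducible `g` of degree `≥ 2` there is `C` with
`#{(n, p) : n ≤ x < p prime, p ∣ g(n), p² < |g(n)|} ≤ C·x` for all `x ≥ 2` (each `n` has at most `log|g(n)|/log x = d + O(1/log x)`
prime divisors beyond `x`). [this work] -/
theorem exists_polyLocatedPrimeCount_le {g : ℤ[X]} (hirr : Irreducible g) (hdeg : 2 ≤ g.natDegree) :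
    ∃ C : ℝ, ∀ x : ℕ, 2 ≤ x → (polyLocatedPrimeCount g x : ℝ) ≤ C * x := by
  have hdeg0 : 0 < g.natDegree := by omega
  obtain ⟨B, hB⟩ := exists_abs_log_natAbs_eval_sub_le hdeg0
  have hB0 : 0 ≤ B := le_trans (abs_nonneg _) (hB 1 le_rfl)
  refine ⟨(g.natDegree : ℝ) + B / Real.log 2, fun x hx => ?_⟩
  have hx1 : 1 ≤ x := by omega
  have hxR : (2 : ℝ) ≤ x := by exact_mod_cast hx
  have hlog2 : 0 < Real.log (2 : ℝ) := Real.log_pos (by norm_num)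
  have hlogx : Real.log 2 ≤ Real.log (x : ℝ) := Real.log_le_log (by norm_num) hxR
  have hlogx0 : 0 < Real.log (x : ℝ) := lt_of_lt_of_le hlog2 hlogx
  -- per-`n` bound: the located primes at `n` are prime factors of `|g(n)|` beyond `x`
  have hn_bound : ∀ n ∈ Icc 1 x,
      (#((((g.eval (n : ℤ)).natAbs.divisors).filter fun e => x < e ∧ e * e < (g.eval (n : ℤ)).natAbs).filter
          Nat.Prime) : ℝ) * Real.log x ≤ (g.natDegree : ℝ) * Real.log n + B := by
    intro n hn
    rw [mem_Icc] at hn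
    have hgz : g.eval (n : ℤ) ≠ 0 := eval_natCast_ne_zero_of_irreducible hirr hdeg n
    set N : ℕ := (g.eval (n : ℤ)).natAbs with hN
    have hN0 : N ≠ 0 := Int.natAbs_ne_zero.mpr hgz
    have hsub : ((N.divisors.filter fun e => x < e ∧ e * e < N).filter Nat.Prime) ⊆
        N.primeFactors.filter fun p => x < p := by
      intro p hp
      simp only [mem_filter, Nat.mem_divisors] at hp
      rw [mem_filter, Nat.mem_primeFactors]
      exact ⟨⟨hp.2, hp.1.1.1, hN0⟩, hp.1.2.1⟩
    have h1 : ((#((N.divisors.filter fun e => x < e ∧ e * e < N).filter Nat.Prime)) : ℝ) * Real.log x ≤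
        (#(N.primeFactors.filter fun p => x < p) : ℝ) * Real.log x :=
      mul_le_mul_of_nonneg_right (by exact_mod_cast card_le_card hsub) hlogx0.le
    have h2 := card_primeFactors_filter_mul_log_le hN0 hx1
    have h3 := hB n hn.1
    rw [← hN] at h3
    have h4 := (abs_le.mp h3).2
    linarith
  -- sum over `n`
  have hsum : (polyLocatedPrimeCount g x : ℝ) * Real.log x ≤
      ∑ n ∈ Icc 1 x, ((g.natDegree : ℝ) * Real.log n + B) := by
    unfold polyLocatedPrimeCount
    push_cast
    rw [sum_mul]
    exact sum_le_sum hn_bound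
  have hcard : ((Icc 1 x).card : ℝ) = x := by rw [Nat.card_Icc]; push_cast; ring
  rw [sum_add_distrib, sum_const, nsmul_eq_mul, hcard, ← mul_sum] at hsum
  have hSlog := sum_Icc_log_le_mul_log x
  have hd0 : (0 : ℝ) ≤ g.natDegree := Nat.cast_nonneg _
  -- `P · log x ≤ d x log x + B x`, divide by `log x ≥ log 2`
  have h5 : (polyLocatedPrimeCount g x : ℝ) * Real.log x ≤
      ((g.natDegree : ℝ) * x) * Real.log x + B * x := by
    nlinarith [mul_le_mul_of_nonneg_left hSlog hd0]
  have hxpos : (0 : ℝ) < x := by linarith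
  have h6 : B * x ≤ (B / Real.log 2 * x) * Real.log x := by
    rw [div_mul_eq_mul_div, div_mul_eq_mul_div, le_div_iff₀ hlog2]
    nlinarith [mul_le_mul_of_nonneg_left hlogx (by positivity : (0 : ℝ) ≤ B * x)]
  have h7 : (polyLocatedPrimeCount g x : ℝ) * Real.log x ≤
      (((g.natDegree : ℝ) + B / Real.log 2) * x) * Real.log x := by nlinarith
  exact le_of_mul_le_mul_right h7 hlogx0

/-- The located prime root count is `o(x log x)`. -/
theorem tendsto_polyLocatedPrimeCount_div {g : ℤ[X]} (hirr : Irreducible g) (hdeg : 2 ≤ g.natDegree) :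
    Tendsto (fun x : ℕ => (polyLocatedPrimeCount g x : ℝ) / ((x : ℝ) * Real.log x)) atTop (𝓝 0) := by
  obtain ⟨C, hC⟩ := exists_polyLocatedPrimeCount_le hirr hdeg
  refine tendsto_div_mul_log_of_abs_le (C := C) fun x hx => ?_
  rw [abs_of_nonneg (Nat.cast_nonneg _)]
  exact hC x hx

/-- **The conjecture lives on composite moduli**: for irreducible `g` of degree `d ≥ 2`,
`LocatedRootCountAsymptotic g` iff the located root count over COMPOSITE moduli, `Mid_g(x) − MidPrime_g(x)`, is
`~ ((d−2)/2)·A_g·x log x`. [this work] -/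
theorem locatedRootCountAsymptotic_iff_composite {g : ℤ[X]} (hirr : Irreducible g) (hdeg : 2 ≤ g.natDegree) :
    LocatedRootCountAsymptotic g ↔
      Tendsto (fun x : ℕ => ((polyLocatedRootCount g x : ℝ) - polyLocatedPrimeCount g x) / ((x : ℝ) * Real.log x))
        atTop (𝓝 (((g.natDegree : ℝ) - 2) / 2 * rootLevelConst g)) := by
  have hP := tendsto_polyLocatedPrimeCount_div hirr hdeg
  unfold LocatedRootCountAsymptotic
  constructor
  · intro hM
    have := hM.sub hP
    rw [sub_zero] at this
    exact this.congr fun x => by rw [sub_div]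
  · intro hC
    have := hC.add hP
    rw [add_zero] at this
    exact this.congr fun x => by rw [sub_div, sub_add_cancel]

end Summit.Parity.BatemanHorn.Theorems
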